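import Literature.MathematicalPhysics.QuantumFieldTheory.BalabanImbrieJaffe1984to88.BIJ85Ineq722ProofPart2
import Literature.MathematicalPhysics.QuantumFieldTheory.Balaban1983to89.B3TorusRadialSums
import Literature.MathematicalPhysics.QuantumFieldTheory.Balaban1983to89.B5Eq118OneStroke

/-!
# `BalabanImbrieJaffe1984to88.BIJ85Ineq722Torus` — T. Bałaban, J. Imbrie, A. Jaffe, *Renormalization of the Higgs model: minimizers,
propagators and the stability of mean field theory*, Commun. Math. Phys. **97** (1985) 299–329 [BalabanImbrieJaffe1985]: Sect. 7.2 p. 325,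
**(7.2.1)–(7.2.2) ON THE TORUS** — file 3 of row C1.Eq7.2.1-7.2.2 (file 1 `…BIJ85Ineq722Proof`: the representation (1.103) of [6I]
`H_k = GQ^*(QGQ^*)⁻¹` as kernels and the decay of `(QGQ^*)⁻¹`, `|H|`, `|∇H|`; file 2 `…BIJ85Ineq722ProofPart2`: the Hölder member, the typed row
`…BIJ85Sect7Statements.KernelData.Ineq722` for abstract families `ℕ → Rep103`).  THIS FILE instantiates the abstract derivation on the torus
`Setup` of the tree (`T_η = T^{(0)} = Site P 0`, `T₁^{(k)} = T^{(k)} = Site P k`, the `k`-fold block map `iterBlockOf k`, the `ℓ^∞` torus distance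
`LatticeFieldCalculus.supDist`, the averaging operators of [6I] (1.18) through `B5Eq118OneStroke`) and PROVES every geometric and averaging
hypothesis of files 1–2 there, so that (7.2.2) = `KernelData.Ineq722` holds on the torus GIVEN ONLY the analytic inputs of [6I]: the symmetry of
`G` (Prop. 1.1 p. 33), the lower bound (1.100) p. 34, and Proposition 1.2 (1.110)–(1.111) p. 35 (by its tree name `B5.Prop12Printed`).

statement-level skeleton of published theorems with citation tags; proofs where landed; nothing here is a claim about the Yang–Mills mass gap

PDF held: `paper:balaban1985-cmp97-bij-higgs-minimizers` (journal page = PDF page + 298; p. 325 = PDF 27) and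
`paper:balaban1984-cmp95-propagators-rt-i` ([6I] = [Balaban1984PropagatorsI]; journal page = PDF page + 16; pp. 20, 34–35 = PDF 4, 18–19);
text layers read this session.

CITATION HEADER (lean-in-tree rule).  Part of the lit-balaban TYPED SKELETON (HOME `run/shared/lean/pub/lit-balaban/`), Phase-2 seat p09 gen 4;
row **C1.Eq7.2.1-7.2.2** of `HOME/SKELETON.md` (typed `…BIJ85Sect7Statements.KernelData.Ineq722` p239582; reader file
`HOME/lit-balaban-r15/ROWS-C1.md`, owner r15, referee ref-5).

THE PRINTED TEXT (verbatim).  [BalabanImbrieJaffe1985] p. 325 [PDF 27]: *"(H_kB)_μ(x) = Σ_{y∈T₁^{(k)},ν} H_{k,μν}(x; y)B_ν(y). (7.2.1) The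
kernel H_{k,μν}(x,y) and its gradient decay exponentially. In particular there exists δ > 0 and for 0 ≤ α < 1 a constant M = M(α) < ∞ such
that for |x − x′| ≤ 1, |H_{k,μν}(x,y)| + |∇H_{k,μν}(x,y)| + |x − x′|^{−α}|∇H_{k,μν}(x,y) − ∇H_{k,μν}(x′,y)| ≤ Me^{−δ|x−y|}. (7.2.2) This
inequality is a consequence of Proposition 1.2 and the representation (1.103) of [6I]."*  [6I] p. 20 [PDF 4]: *"(Q_kA)_b = Σ_{x∈B^k(b₋)}
η^{d+1} A([x, x(b)]), b ⊂ T₁^{(k)} = ℤ^d ∩ T_η, η = L^{−k}, (1.18) and x(b) is a point in B^k(b₊) obtained from x by translation by b. If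
b = ⟨y, y + e_μ⟩, then x(b) = x + e_μ."*  [6I] p. 35 [PDF 19]: *"Cubes Δ(y) are simply unit cubes of T_η, or Δ(y) = B^k(y), y ∈ T₁^{(k)}.
Cubes Δ̃(y) are sums of 2^d unit cubes having the point y as a corner, thus they are cubes of size 2 and with a center at y."*

WHAT IS PROVED (everything below is a theorem; the file introduces no Prop-valued fact and no hypothesis bundle beyond `TorusHyps`, the
non-geometric fields of file 1's `Rep103.Hyps`).
* §A — the `ℓ^∞` torus geometry of the block centres (lattice steps of `T^{(0)}`, standing range `k ≤ m + K` of `Setup`): the triangle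
  inequality for `supDist` (`supDist_triangle`; pseudo-distance `supDist_isPseudoDist`, uniform lattice sums `supDist_sumBound` =
  `B3TorusRadialSums.sum_exp_neg_supDist_le`, `KY(a) = (2(1 + d/a))^d` for every torus and every `k`); the centre `ctr k y ∈ T^{(0)}` of the
  `k`-block `B^k(y)` (label `nL^k + (L^k − 1)/2`; `val_ctr`); `|x − y_x|_∞ ≤ (L^k − 1)/2` (`supDist_ctr_blk_le`); `|y_q − y_{q′}|_∞ = L^k|q − q′|_∞`
  (`supDist_ctr_ctr`); hence `|x − x′|_∞ ≤ L^k ⟹ |x_k − x′_k|_∞ ≤ 1` (`supDist_blk_le_one`) and `|x − y_q|_∞ ≤ (L^k−1)/2 + L^k|x_k − q|_∞`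
  (`supDist_ctr_le`).
* §B — the carrier `torusRep P k D : Rep103` of scale `k` (`D : TorusData` = the kernels `G`, `∇G`, `Q^*`): `|x − x′| = |x − x′|_∞/L^k`,
  `|y − y′| = |y − y′|_∞`, `y_x = iterBlockOf k x`, `Δ̃(y) = {x : |x − y|_∞ < L^k}` (the open cube of size 2 centred at the centre of `B^k(y)`; centred
  convention DIVERGENCE F3), weight `η^d`; the remaining analytic inputs `TorusHyps` (range/row sums of `Q^*`, `Q`; symmetry of `G`; (1.100)).
* §C — the geometric hypotheses of files 1–2 DISCHARGED: `hyps_torus : TorusHyps … → (torusRep P k D).Hyps γ₁ q₀ q₁ r_Q KYd`,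
  `cutoffHyps_torus : CutoffHyps (torusRep P k D) ¼ 4 0 1` (the cut-offs of (1.111) from `cutoff_of_balls` with the block centres),
  `distEU_le : |x − y| ≤ |y_x − y| + ½` for the inter-lattice distance `distEU` = `|x − ctr y|_∞/L^k`, `dS_pos`, `card_dir`.
* §D — **`ineq722_torus` / `ineq722_torus_of_prop12Printed : KernelData.Ineq722 (k ↦ torusKernelData P (lev k) (D k) …)`** for every
  indexing `lev : ℕ → ℕ` of the standing range (`levStd k = min k (m+K)`), given `TorusHyps` at k-independent constants and the three members
  of Prop. 1.2 (`Prop12Hyps`) / `B5.Prop12Printed` for the torus carriers.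
* §E — **the averaging kernel of (1.18) CONCRETELY**: `QsStd P k (⟨x′,μ⟩) (⟨y,ν⟩) = δ_{μν}L^{−k}·strokeCount` (`strokeCount` = the number of
  contours `[x, x + e_ν]`, `x ∈ B^k(y)`, through the fine bond `⟨x′, x′ + ηe_ν⟩`); `torusRep_std_Q_mulVec`: `Q = η^d(Q^*)ᵀ` applied to a bond
  field IS `LatticeFieldCalculus.bondAvgIter k` (through `B5Eq118OneStroke.eq118`); the `Q`-clauses of `Hyps` as theorems with
  `q₀ = q₁ = r_Q = 1`: `QsStd_row` (`Σ_c Q^*(b,c) = 1`), `torusRep_std_Q_row` (`Σ_b |Q(c,b)| = 1`), `QsStd_range` (`Q^*(⟨x′,μ⟩,⟨y,ν⟩) ≠ 0 ⟹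
  |y_{x′} − y|_∞ ≤ 1`); and **`ineq722_torusStd` / `ineq722_torusStd_of_prop12Printed`**: `KernelData.Ineq722` on the torus with the
  averaging operators of (1.18), GIVEN ONLY `G_k` symmetric, (1.100) at a k-independent `γ₁`, and Prop. 1.2 (resp. `B5.Prop12Printed`).
HONEST SCOPE.  [6I] Proposition 1.2 (row B5.Prop1.2, typed `B5.Prop12Printed`, NOT proved in the tree), the lower bound (1.100)–(1.101) and
the symmetry clause of Prop. 1.1 for the given kernels `G_k = G̃_k(ΩA)`, `∇G_k` remain HYPOTHESES OF THE PRINTED SHAPE; the identification of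
`G_k` with the inverse of `Δ(ΩA) + Q_k^*Q_k + …` of [6I] (1.99) is the instantiator's (row B5.Eq1.103).  Outside the standing range
`k ≤ m + K` the site counts of `Setup` are truncated, whence the indexing `lev`.  Unit `lit-balaban-p09`
(literature-prover-lit-balaban-p09-g4-0), 2026-08-21.
-/

namespace Literature.MathematicalPhysics.QuantumFieldTheory.BalabanImbrieJaffe1984to88.BIJ85Ineq722Torus

open Literature.MathematicalPhysics.QuantumFieldTheory.Balaban1983to89
open scoped BigOperators Matrix
open LatticeFieldCalculus B3TorusRadialSums B5Eq118OneStroke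

noncomputable section

/-! ## §A  The `ℓ^∞` torus geometry of the block centres -/

section Cdist

variable {N : ℕ} [NeZero N]

/-- Subadditivity of the circular size on `ℤ/N` (the `cdist` form of p03 gen 2's `circ_add_le`). [folklore] -/
private theorem cdist_add_le (a b : ZMod N) : cdist (a + b) ≤ cdist a + cdist b := by
  unfold cdist
  rcases le_total a.val (-a).val with ha | ha <;> rcases le_total b.val (-b).val with hb | hb
  · rw [min_eq_left ha, min_eq_left hb]
    exact (min_le_left _ _).trans (ZMod.val_add_le a b)
  · rw [min_eq_left ha, min_eq_right hb]
    rcases le_total (-b).val a.val with h | h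
    · have e : a + b = a - -b := by ring
      calc min (a + b).val (-(a + b)).val ≤ (a + b).val := min_le_left _ _
        _ = a.val - (-b).val := by rw [e, ZMod.val_sub h]
        _ ≤ a.val + (-b).val := by omega
    · have e : -(a + b) = -b - a := by ring
      calc min (a + b).val (-(a + b)).val ≤ (-(a + b)).val := min_le_right _ _
        _ = (-b).val - a.val := by rw [e, ZMod.val_sub h]
        _ ≤ a.val + (-b).val := by omega
  · rw [min_eq_right ha, min_eq_left hb]
    rcases le_total (-a).val b.val with h | h
    · have e : a + b = b - -a := by ring
      calc min (a + b).val (-(a + b)).val ≤ (a + b).val := min_le_left _ _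
        _ = b.val - (-a).val := by rw [e, ZMod.val_sub h]
        _ ≤ (-a).val + b.val := by omega
    · have e : -(a + b) = -a - b := by ring
      calc min (a + b).val (-(a + b)).val ≤ (-(a + b)).val := min_le_right _ _
        _ = (-a).val - b.val := by rw [e, ZMod.val_sub h]
        _ ≤ (-a).val + b.val := by omega
  · rw [min_eq_right ha, min_eq_right hb]
    have e : -(a + b) = -a + -b := by ring
    calc min (a + b).val (-(a + b)).val ≤ (-(a + b)).val := min_le_right _ _
      _ ≤ (-a).val + (-b).val := by rw [e]; exact ZMod.val_add_le _ _

/-- kernel: `(−m).val` in terms of `m.val` — `0` if `m = 0`, else `N − m.val`; so `P·(−m).val` is the same expression one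
modulus up. [folklore] -/
private theorem neg_val_mul {M : ℕ} [NeZero M] (m : ZMod N) (w : ZMod M) (c : ℕ) (hMN : M = N * c)
    (hw : w.val = m.val * c) : (-w).val = (-m).val * c := by
  rw [ZMod.neg_val, ZMod.neg_val]
  by_cases hm : m = 0
  · have : w = 0 := by
      rw [← ZMod.val_eq_zero] at hm ⊢
      rw [hw, hm, zero_mul]
    rw [if_pos hm, if_pos this, zero_mul]
  · rcases Nat.eq_zero_or_pos c with hc | hc
    · subst hc
      have : w = 0 := by rw [← ZMod.val_eq_zero, hw, mul_zero]
      rw [if_pos this]; simp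
    · have hw0 : w ≠ 0 := by
        intro h0
        rw [← ZMod.val_eq_zero, hw] at h0
        rcases mul_eq_zero.mp h0 with h1 | h1
        · exact hm ((ZMod.val_eq_zero m).mp h1)
        · omega
      rw [if_neg hm, if_neg hw0, Nat.sub_mul, ← hMN, ← hw]

end Cdist

variable {P : Params}

/-- **Triangle inequality for the `ℓ^∞` torus distance** `LatticeFieldCalculus.supDist` (lattice steps), `|x − y| = max_μ min{|x_μ − y_μ|,
2L_μ − |x_μ − y_μ|}`. [cite: Balaban1982Higgs1, (1.3) p.604] -/
theorem supDist_triangle {j : ℕ} (x y z : Site P j) : supDist x z ≤ supDist x y + supDist y z := by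
  rw [supDist_eq_sup_cdist, supDist_eq_sup_cdist, supDist_eq_sup_cdist]
  refine Finset.sup_le fun μ hμ => ?_
  have e1 : x μ - z μ = (x μ - y μ) + (y μ - z μ) := by ring
  rw [e1]
  exact (cdist_add_le _ _).trans (add_le_add (Finset.le_sup (f := fun μ => cdist (x μ - y μ)) hμ)
    (Finset.le_sup (f := fun μ => cdist (y μ - z μ)) hμ))

/-- The scaled `ℓ^∞` torus distance `|x − y|_∞ / c` (`c ≥ 0`; `c = L^k` = the number of `η`-steps per unit length) is a pseudo-distance
in the sense of `B4Sect5Torus.IsPseudoDist`. [cite: Balaban1982Higgs1, (1.3) p.604] -/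
theorem supDist_div_isPseudoDist (j : ℕ) {c : ℝ} (hc : 0 ≤ c) :
    B4Sect5Torus.IsPseudoDist (fun x y : Site P j => (supDist x y : ℝ) / c) where
  symm x y := by simp only [supDist_comm]
  zero x := by rw [(supDist_eq_zero_iff x x).mpr rfl]; simp
  triangle x y z := by
    rw [← add_div]
    refine div_le_div_of_nonneg_right ?_ hc
    exact_mod_cast supDist_triangle x y z

/-- The `ℓ^∞` torus distance itself is a pseudo-distance. [cite: Balaban1982Higgs1, (1.3) p.604] -/
theorem supDist_isPseudoDist (j : ℕ) : B4Sect5Torus.IsPseudoDist (fun x y : Site P j => (supDist x y : ℝ)) := by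
  have h := supDist_div_isPseudoDist (P := P) j zero_le_one
  simp only [div_one] at h
  exact h

/-- The lattice-sum profile of `T^{(j)}` in the `ℓ^∞` distance, UNIFORM IN THE TORUS: `Σ_{y′} e^{−a|y−y′|_∞} ≤ (2(1 + d/a))^d`
(`B3TorusRadialSums.sum_exp_neg_supDist_le`), i.e. `B4Sect5Torus.SumBound` with `K(a) = (2(1 + d/a))^d`. [cite: Balaban1983Higgs3, (2.15) p.427] -/
theorem supDist_sumBound (j : ℕ) :
    B4Sect5Torus.SumBound (fun x y : Site P j => (supDist x y : ℝ)) (fun a => (2 * (1 + P.d / a)) ^ P.d) :=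
  fun _ ha y => sum_exp_neg_supDist_le ha (by have := P.hd; omega) y

/-- The profile `K(a) = (2(1 + d/a))^d` is nonnegative for `a > 0`. [folklore] -/
private theorem sumProfile_nonneg {a : ℝ} (ha : 0 < a) : 0 ≤ (2 * (1 + (P.d : ℝ) / a)) ^ P.d := by positivity

/-! ### Block centres -/

/-- In the standing range `k ≤ m + K`: `T^{(0)}` has `L^k` times as many sites per direction as `T^{(k)}`. [cite: Balaban1987RG1, (0.1) p.251] -/
theorem sitesPerDir_zero_eq {k : ℕ} (hk : k ≤ P.m + P.K) : P.sitesPerDir 0 = P.sitesPerDir k * P.L ^ k := by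
  unfold Params.sitesPerDir
  rw [mul_assoc, ← pow_add]
  congr 2
  omega

/-- THE CENTRE OF A `k`-BLOCK as a point of the fine lattice: the label `n ↦ nL^k + (L^k − 1)/2` (the `k`-fold iterate of `Setup.emb`,
centred convention DIVERGENCE F3; `L^k` odd). [cite: Balaban1987RG1, (0.1) p.252] -/
def ctr (k : ℕ) (y : Site P k) : Site P 0 :=
  fun μ => (((y μ).val * P.L ^ k + (P.L ^ k - 1) / 2 : ℕ) : ZMod (P.sitesPerDir 0))

/-- `1 ≤ L^k`. [folklore] -/
private theorem one_le_pow_L (k : ℕ) : 1 ≤ P.L ^ k := Nat.one_le_pow _ _ P.L_pos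

/-- The label of the centre is `nL^k + (L^k − 1)/2` (no reduction modulo the site count; standing range) — B12's labelling `n ↦ (n + ½)·spacing`
of the centred cubes, `k` levels down. [cite: Balaban1987RG1, (0.1) p.252] -/
theorem val_ctr {k : ℕ} (hk : k ≤ P.m + P.K) (y : Site P k) (μ : Fin P.d) :
    ((ctr k y) μ).val = (y μ).val * P.L ^ k + (P.L ^ k - 1) / 2 := by
  simp only [ctr]
  rw [ZMod.val_natCast, Nat.mod_eq_of_lt]
  have hy : (y μ).val + 1 ≤ P.sitesPerDir k := ZMod.val_lt (y μ)
  have h1 : ((y μ).val + 1) * P.L ^ k ≤ P.sitesPerDir k * P.L ^ k := Nat.mul_le_mul_right _ hy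
  have h2 : (P.L ^ k - 1) / 2 < P.L ^ k := by have := one_le_pow_L (P := P) k; omega
  rw [sitesPerDir_zero_eq hk]
  rw [Nat.add_mul, one_mul] at h1
  omega

/-- kernel arithmetic: a label `t + r`, `r < 2h + 1`, is within `h` of the centre label `t + h`. [folklore] -/
private theorem center_arith {t r h av cv : ℕ} (hav : av = t + r) (hcv : cv = t + h) (hr : r < 2 * h + 1) :
    (h ≤ r → av - cv ≤ h ∧ cv ≤ av) ∧ (r < h → cv - av ≤ h ∧ av ≤ cv) := by
  constructor <;> intro <;> omega

/-- **A fine site is within `(L^k − 1)/2` lattice steps of the centre of its `k`-block, coordinatewise.** [cite: Balaban1987RG1, (0.1) p.252] -/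
theorem cdist_sub_ctr_blk_le {k : ℕ} (hk : k ≤ P.m + P.K) (x : Site P 0) (μ : Fin P.d) :
    cdist (x μ - (ctr k (iterBlockOf k x)) μ) ≤ (P.L ^ k - 1) / 2 := by
  obtain ⟨h, hh⟩ : Odd (P.L ^ k) := P.hL.1.pow
  have hval : P.L ^ k * ((x μ).val / P.L ^ k) + (x μ).val % P.L ^ k = (x μ).val := Nat.div_add_mod _ _
  have hr : (x μ).val % P.L ^ k < P.L ^ k := Nat.mod_lt _ (by have := one_le_pow_L (P := P) k; omega)
  have hc : ((ctr k (iterBlockOf k x)) μ).val = P.L ^ k * ((x μ).val / P.L ^ k) + (P.L ^ k - 1) / 2 := by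
    rw [val_ctr hk, val_iterBlockOf k hk x μ, mul_comm]
  have hh2 : (P.L ^ k - 1) / 2 = h := by omega
  rw [hh2] at hc ⊢
  have key := center_arith hval.symm hc (hr.trans_eq hh)
  rcases lt_or_ge ((x μ).val % P.L ^ k) h with hlt | hle
  · obtain ⟨h1, h2⟩ := key.2 hlt
    rw [← neg_sub, cdist_neg]
    calc cdist ((ctr k (iterBlockOf k x)) μ - x μ) ≤ ((ctr k (iterBlockOf k x)) μ - x μ).val := cdist_le_val _
      _ = ((ctr k (iterBlockOf k x)) μ).val - (x μ).val := ZMod.val_sub h2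
      _ ≤ h := h1
  · obtain ⟨h1, h2⟩ := key.1 hle
    calc cdist (x μ - (ctr k (iterBlockOf k x)) μ) ≤ (x μ - (ctr k (iterBlockOf k x)) μ).val := cdist_le_val _
      _ = (x μ).val - ((ctr k (iterBlockOf k x)) μ).val := ZMod.val_sub h2
      _ ≤ h := h1

/-- **`|x − y_x|_∞ ≤ (L^k − 1)/2`** for the centre `y_x` of the `k`-block of `x` (lattice steps of `T^{(0)}`), i.e. `< ½` in the unit
of `T₁^{(k)}`. [cite: Balaban1987RG1, (0.1) p.252] -/
theorem supDist_ctr_blk_le {k : ℕ} (hk : k ≤ P.m + P.K) (x : Site P 0) : supDist x (ctr k (iterBlockOf k x)) ≤ (P.L ^ k - 1) / 2 := by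
  rw [supDist_eq_sup_cdist]
  exact Finset.sup_le fun μ _ => cdist_sub_ctr_blk_le hk x μ

/-- kernel: the difference of two centres is `L^k` times the difference of the labels, one modulus up. [folklore] -/
private theorem ctr_sub_ctr_val {k : ℕ} (hk : k ≤ P.m + P.K) (q q' : Site P k) (μ : Fin P.d) (hle : (q' μ).val ≤ (q μ).val) :
    ((ctr k q) μ - (ctr k q') μ).val = (q μ - q' μ).val * P.L ^ k := by
  have h1 : ((ctr k q') μ).val ≤ ((ctr k q) μ).val := by
    rw [val_ctr hk, val_ctr hk]
    have := Nat.mul_le_mul_right (P.L ^ k) hle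
    omega
  rw [ZMod.val_sub h1, ZMod.val_sub hle, val_ctr hk, val_ctr hk, Nat.sub_mul]
  omega

/-- **The centres are `L^k` apart exactly as their labels, coordinatewise**: `cdist(y_q − y_{q′}) = L^k · cdist(q − q′)` (the fine torus has
`L^k` times the sites of the coarse one per direction). [cite: Balaban1987RG1, (0.1) p.251] -/
theorem cdist_ctr_sub_ctr {k : ℕ} (hk : k ≤ P.m + P.K) (q q' : Site P k) (μ : Fin P.d) :
    cdist ((ctr k q) μ - (ctr k q') μ) = P.L ^ k * cdist (q μ - q' μ) := by
  -- without loss of generality `q′.val ≤ q.val`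
  suffices hwlog : ∀ q q' : Site P k, (q' μ).val ≤ (q μ).val →
      cdist ((ctr k q) μ - (ctr k q') μ) = P.L ^ k * cdist (q μ - q' μ) by
    rcases le_total (q' μ).val (q μ).val with h | h
    · exact hwlog q q' h
    · rw [← neg_sub, cdist_neg, ← neg_sub (q' μ), cdist_neg]
      exact hwlog q' q h
  intro q q' hle
  have hv := ctr_sub_ctr_val hk q q' μ hle
  have hn := neg_val_mul (q μ - q' μ) ((ctr k q) μ - (ctr k q') μ) (P.L ^ k) (sitesPerDir_zero_eq hk) hv
  unfold cdist
  rw [hv, hn, mul_comm _ (P.L ^ k), mul_comm _ (P.L ^ k), mul_min_of_nonneg _ _ (Nat.zero_le _)]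

/-- **`|y_q − y_{q′}|_∞ = L^k |q − q′|_∞`**: the centres of the `k`-blocks, as points of `T^{(0)}`, reproduce the `ℓ^∞` distance of
`T^{(k)}` in the unit `L^k` lattice steps (`= 1` in the unit of `T₁^{(k)}`). [cite: Balaban1987RG1, (0.1) p.251] -/
theorem supDist_ctr_ctr {k : ℕ} (hk : k ≤ P.m + P.K) (q q' : Site P k) :
    supDist (ctr k q) (ctr k q') = P.L ^ k * supDist q q' := by
  rw [supDist_eq_sup_cdist, supDist_eq_sup_cdist]
  rw [Finset.apply_sup_eq_sup_comp (fun n : ℕ => P.L ^ k * n) (fun a b => mul_max_of_nonneg a b (Nat.zero_le _))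
    (by simp)]
  congr 1
  funext μ
  exact cdist_ctr_sub_ctr hk q q' μ

/-- **Nearby fine sites have nearby blocks**: `L^k |x_k − x′_k|_∞ ≤ |x − x′|_∞ + (L^k − 1)` (`x_k` = the `k`-block of `x`; through the
two centres and the triangle inequality). [cite: BalabanImbrieJaffe1985, (5.1.2)–(5.1.3) p.313] -/
theorem mul_supDist_blk_le {k : ℕ} (hk : k ≤ P.m + P.K) (x x' : Site P 0) :
    P.L ^ k * supDist (iterBlockOf k x) (iterBlockOf k x') ≤ supDist x x' + (P.L ^ k - 1) := by
  rw [← supDist_ctr_ctr hk]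
  have h1 := supDist_triangle (ctr k (iterBlockOf k x)) x (ctr k (iterBlockOf k x'))
  have h2 := supDist_triangle x x' (ctr k (iterBlockOf k x'))
  have h3 := supDist_ctr_blk_le hk x
  have h4 := supDist_ctr_blk_le hk x'
  rw [supDist_comm] at h3
  omega

/-- `|x − x′|_∞ ≤ L^k ⟹ |x_k − x′_k|_∞ ≤ 1`: fine sites at most one unit apart lie in the same or in adjacent `k`-blocks.
[cite: BalabanImbrieJaffe1985, (5.1.2)–(5.1.3) p.313] -/
theorem supDist_blk_le_one {k : ℕ} (hk : k ≤ P.m + P.K) (x x' : Site P 0) (h : supDist x x' ≤ P.L ^ k) :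
    supDist (iterBlockOf k x) (iterBlockOf k x') ≤ 1 := by
  have h1 := mul_supDist_blk_le hk x x'
  have hL := one_le_pow_L (P := P) k
  by_contra h2
  rw [not_le] at h2
  have h3 : P.L ^ k * 2 ≤ P.L ^ k * supDist (iterBlockOf k x) (iterBlockOf k x') := Nat.mul_le_mul_left _ h2
  omega

/-- `|x − y_{q}|_∞ ≤ (L^k − 1)/2 + L^k |x_k − q|_∞`: the distance from a fine site to any block centre through the centre of its own
block. [cite: BalabanImbrieJaffe1985, (5.1.2)–(5.1.3) p.313] -/
theorem supDist_ctr_le {k : ℕ} (hk : k ≤ P.m + P.K) (x : Site P 0) (q : Site P k) :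
    supDist x (ctr k q) ≤ (P.L ^ k - 1) / 2 + P.L ^ k * supDist (iterBlockOf k x) q := by
  rw [← supDist_ctr_ctr hk]
  exact (supDist_triangle x (ctr k (iterBlockOf k x)) (ctr k q)).trans (add_le_add_left (supDist_ctr_blk_le hk x) _)

/-! ## §B  The representation (1.103) on the torus at scale `k`: the Sect. 7.2 carrier `Rep103` of `T_η = T^{(0)}`, `T₁^{(k)} = T^{(k)}` -/

open BIJ85Ineq722Proof BIJ85Ineq722Proof.Rep103 BIJ85Ineq722ProofPart2 BIJ85Sect7Statements

/-- THE ANALYTIC DATA OF SCALE `k` ON THE TORUS: the kernels of `G = G̃_k(ΩA)` on the fine vector fields of `T_η = T^{(0)}` (index `⟨x, μ⟩`),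
of `J ↦ ∇GJ` (index `(x, λ, μ)`), and of the adjoint averaging operator `Q_k^*` from the unit-lattice vector fields of `T₁^{(k)} = T^{(k)}`
(index `⟨y, ν⟩`) — the objects of [6I] (1.103) `H_kB = GQ^*(QGQ^*)⁻¹B` at step `k` of the torus `Setup`. [cite: Balaban1984PropagatorsI, (1.103) p.34] -/
structure TorusData (P : Params) (k : ℕ) where
  /-- kernel of `G`: `(GJ)_μ(x) = Σ G (x,μ) (x′,μ′) J_{μ′}(x′)` -/
  G : Matrix (Site P 0 × Fin P.d) (Site P 0 × Fin P.d) ℝ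
  /-- kernel of `J ↦ ∇GJ` -/
  DG : Matrix (Site P 0 × Fin P.d × Fin P.d) (Site P 0 × Fin P.d) ℝ
  /-- kernel of `Q_k^*` -/
  Qs : Matrix (Site P 0 × Fin P.d) (Site P k × Fin P.d) ℝ

/-- **The Sect. 7.2 carrier of the representation (1.103) ON THE TORUS at scale `k`** (`BIJ85Ineq722Proof.Rep103`): fine sites
`T_η = T^{(0)}`, unit sites `T₁^{(k)} = T^{(k)}`, `d` directions; `|x − x′| = |x − x′|_∞/L^k` and `|y − y′| = |y − y′|_∞` (the `ℓ^∞` torus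
distances in the unit of `T₁^{(k)}`, `L^k` fine steps = 1); `x ↦ y_x` = the `k`-fold block map `iterBlockOf k` ((5.1.2)–(5.1.3)); `Δ̃(y)` = the
open cube of size 2 centred at the centre of `B^k(y)` (p. 35: *"cubes of size 2 and with a center at y"*; centred convention DIVERGENCE F3),
`{x : |x − y|_∞ < L^k}`; the kernels `G, ∇G, Q^*` of `TorusData`; the weight `η^d`, `η = L^{−k}`. [cite: BalabanImbrieJaffe1985, (7.2.1) p.325] -/
def torusRep (P : Params) (k : ℕ) (D : TorusData P k) : Rep103 where
  S := Site P 0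
  Y := Site P k
  Dir := Fin P.d
  dS := fun x x' => (supDist x x' : ℝ) / (P.L : ℝ) ^ k
  dY := fun y y' => (supDist y y' : ℝ)
  blk := iterBlockOf k
  cube := fun y => {x | (supDist x (ctr k y) : ℝ) / (P.L : ℝ) ^ k < 1}
  G := D.G
  DG := D.DG
  Qs := D.Qs
  wη := P.eta k ^ P.d

variable {k : ℕ} {D : TorusData P k}

/-- `0 < L^k` in `ℝ`. [folklore] -/
private theorem cast_pow_L_pos (k : ℕ) : (0 : ℝ) < (P.L : ℝ) ^ k := pow_pos P.cast_L_pos k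

/-- unfolding: `|x − x′| = |x − x′|_∞ / L^k` on `T_η`. [cite: BalabanImbrieJaffe1985, (7.2.2) p.325] -/
@[simp] theorem torusRep_dS (x x' : Site P 0) : (torusRep P k D).dS x x' = (supDist x x' : ℝ) / (P.L : ℝ) ^ k := rfl

/-- unfolding: `|y − y′| = |y − y′|_∞` on `T₁^{(k)}`. [cite: BalabanImbrieJaffe1985, (7.2.2) p.325] -/
@[simp] theorem torusRep_dY (y y' : Site P k) : (torusRep P k D).dY y y' = (supDist y y' : ℝ) := rfl

/-- unfolding: `y_x = x_k`. [cite: BalabanImbrieJaffe1985, (5.1.2) p.313] -/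
@[simp] theorem torusRep_blk (x : Site P 0) : (torusRep P k D).blk x = iterBlockOf k x := rfl

/-- unfolding: `x ∈ Δ̃(y) ↔ |x − y|_∞ < L^k`. [cite: Balaban1984PropagatorsI, (1.110) p.35] -/
theorem mem_cube_iff (y : Site P k) (x : Site P 0) :
    x ∈ (torusRep P k D).cube y ↔ (supDist x (ctr k y) : ℝ) / (P.L : ℝ) ^ k < 1 := Iff.rfl

/-- `|x − x′| ≤ t ↔ |x − x′|_∞ ≤ tL^k` (the unit of `T₁^{(k)}` is `L^k` steps of `T_η`). [cite: BalabanImbrieJaffe1985, (7.2.2) p.325] -/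
theorem dS_le_iff (x x' : Site P 0) (t : ℝ) : (torusRep P k D).dS x x' ≤ t ↔ (supDist x x' : ℝ) ≤ t * (P.L : ℝ) ^ k := by
  rw [torusRep_dS, div_le_iff₀ (cast_pow_L_pos k)]

/-- THE ANALYTIC INPUTS AT SCALE `k` THAT REMAIN HYPOTHESES on the torus (the geometric ones being discharged below): the averaging
kernels' range and row sums ([6I] (1.18): `Q^*(⟨x′,μ′⟩, b) ≠ 0 ⇒ |y_{x′} − b₋| ≤ r_Q`, `|Q^*w| ≤ q₀|w|`, `|QA| ≤ q₁|A|`), the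
symmetry of `G` ([6I] Prop. 1.1 p. 33) and the lower bound (1.100)–(1.101) `γ₁‖w‖² ≤ ⟨w, QGQ^*w⟩` p. 34 — exactly the non-geometric
fields of `Rep103.Hyps`. [cite: Balaban1984PropagatorsI, (1.100) p.34] -/
structure TorusHyps (P : Params) (k : ℕ) (D : TorusData P k) (γ₁ q₀ q₁ rQ : ℝ) : Prop where
  γ₁_pos : 0 < γ₁
  q₀_nonneg : 0 ≤ q₀
  q₁_nonneg : 0 ≤ q₁
  rQ_nonneg : 0 ≤ rQ
  Qs_range : ∀ (j : Site P 0 × Fin P.d) (p : Site P k × Fin P.d), D.Qs j p ≠ 0 → (supDist (iterBlockOf k j.1) p.1 : ℝ) ≤ rQ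
  Qs_row : ∀ j : Site P 0 × Fin P.d, ∑ p, |D.Qs j p| ≤ q₀
  Q_row : ∀ p : Site P k × Fin P.d, ∑ i, |(torusRep P k D).Q p i| ≤ q₁
  G_symm : D.G.IsSymm
  M_lower : ∀ w : Site P k × Fin P.d → ℝ, γ₁ * ∑ p, w p ^ 2 ≤ ∑ p, w p * ((torusRep P k D).M *ᵥ w) p

/-- The lattice-sum profile of the torus family: `KY(a) = (2(1 + d/a))^d`, THE SAME FOR EVERY `k` AND EVERY TORUS. [cite: Balaban1983Higgs3, (2.15) p.427] -/
def KYd (P : Params) : ℝ → ℝ := fun a => (2 * (1 + (P.d : ℝ) / a)) ^ P.d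

/-! ## §C  The geometric hypotheses of the derivation DISCHARGED on the torus (standing range `k ≤ m + K`) -/

/-- `x ∈ Δ̃(y_x)`: a fine site lies in the doubled cube of its own block (`|x − y_x|_∞ ≤ (L^k − 1)/2 < L^k`). [cite: Balaban1984PropagatorsI, (1.110) p.35] -/
theorem mem_cube_blk (hk : k ≤ P.m + P.K) (x : Site P 0) : x ∈ (torusRep P k D).cube (iterBlockOf k x) := by
  rw [mem_cube_iff, div_lt_one (cast_pow_L_pos k)]
  have h1 := supDist_ctr_blk_le hk x
  have h2 : supDist x (ctr k (iterBlockOf k x)) < P.L ^ k := by have := one_le_pow_L (P := P) k; omega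
  exact_mod_cast h2

/-- `|x − y_x| ≤ ½` in the unit of `T₁^{(k)}`. [cite: Balaban1987RG1, (0.1) p.252] -/
theorem dS_ctr_blk_le_half (hk : k ≤ P.m + P.K) (x : Site P 0) : (torusRep P k D).dS x (ctr k (iterBlockOf k x)) ≤ 1 / 2 := by
  rw [dS_le_iff]
  have h1 := supDist_ctr_blk_le hk x
  have h2 : 2 * supDist x (ctr k (iterBlockOf k x)) ≤ P.L ^ k := by have := one_le_pow_L (P := P) k; omega
  have h3 : (2 : ℝ) * (supDist x (ctr k (iterBlockOf k x)) : ℝ) ≤ (P.L : ℝ) ^ k := by exact_mod_cast h2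
  linarith

/-- **`Rep103.Hyps` for the torus carrier**: the geometric fields (pseudo-distance, uniform lattice sums with `KY = KYd`, `|x − x′| ≥ 0`,
`x ∈ Δ̃(y_x)`) are THEOREMS of the torus; the analytic fields are those of `TorusHyps`. [cite: BalabanImbrieJaffe1985, (7.2.2) p.325] -/
theorem hyps_torus (hk : k ≤ P.m + P.K) {γ₁ q₀ q₁ rQ : ℝ} (h : TorusHyps P k D γ₁ q₀ q₁ rQ) :
    (torusRep P k D).Hyps γ₁ q₀ q₁ rQ (KYd P) where
  γ₁_pos := h.γ₁_pos
  q₀_nonneg := h.q₀_nonneg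
  q₁_nonneg := h.q₁_nonneg
  rQ_nonneg := h.rQ_nonneg
  KY_nonneg := fun _ ha => sumProfile_nonneg ha
  dY_pd := supDist_isPseudoDist k
  sumY := supDist_sumBound k
  dS_nonneg := fun x x' => by rw [torusRep_dS]; positivity
  mem_cube_blk := mem_cube_blk hk
  Qs_range := h.Qs_range
  Qs_row := h.Qs_row
  Q_row := h.Q_row
  G_symm := h.G_symm
  M_lower := h.M_lower

/-- `|x − x′| = |x − x′|_∞/L^k` is a pseudo-distance on `T_η`. [cite: Balaban1982Higgs1, (1.3) p.604] -/
theorem dS_isPseudoDist (k : ℕ) (D : TorusData P k) : B4Sect5Torus.IsPseudoDist (torusRep P k D).dS :=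
  supDist_div_isPseudoDist 0 (cast_pow_L_pos k).le

/-- The ball of radius 1 about the centre of `B^k(y)` is `Δ̃(y)` (by definition of the carrier). [cite: Balaban1984PropagatorsI, (1.110) p.35] -/
theorem ball_sub_cube (y : Site P k) (z : Site P 0) (hz : (torusRep P k D).dS z (ctr k y) < 1) : z ∈ (torusRep P k D).cube y := hz

/-- Every fine site is within `½` of the centre of its own block, whose unit site is at distance `0` from `y_x`. [cite: Balaban1987RG1, (0.1) p.252] -/
theorem exists_ctr_near (hk : k ≤ P.m + P.K) (x : Site P 0) :
    ∃ y : Site P k, (torusRep P k D).dS x (ctr k y) ≤ 1 / 2 ∧ (torusRep P k D).dY ((torusRep P k D).blk x) y ≤ 0 := by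
  refine ⟨iterBlockOf k x, dS_ctr_blk_le_half hk x, ?_⟩
  rw [torusRep_dY, torusRep_blk, (supDist_eq_zero_iff _ _).mpr rfl, Nat.cast_zero]

/-- **The cut-off of (1.111) on the torus**: for `|x − x′| ≤ ¼` a `ζ` supported in `Δ̃(y_x)` with `ζ(x) = ζ(x′) = 1`, `|ζ| ≤ 1`,
`|ζ(z) − ζ(z′)| ≤ 4|z − z′|^α` (`0 < |z − z′| ≤ 1`) — `cutoff_of_balls` with the block centres and radius 1. [cite: Balaban1984PropagatorsI, (1.111) p.35] -/
theorem cutoff_torus (hk : k ≤ P.m + P.K) (x x' : Site P 0) (hxx' : (torusRep P k D).dS x x' ≤ 1 / 4) :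
    ∃ (y : Site P k) (ζ : Site P 0 → ℝ), (∀ z, ζ z ≠ 0 → z ∈ (torusRep P k D).cube y) ∧ ζ x = 1 ∧ ζ x' = 1 ∧ (∀ z, |ζ z| ≤ 1) ∧
      (∀ α : ℝ, 0 ≤ α → α < 1 → ∀ z z', 0 < (torusRep P k D).dS z z' → (torusRep P k D).dS z z' ≤ 1 →
        |ζ z - ζ z'| ≤ 4 * (torusRep P k D).dS z z' ^ α) ∧
      (torusRep P k D).dY ((torusRep P k D).blk x) y ≤ 0 := by
  have h := cutoff_of_balls (R := torusRep P k D) (dS_isPseudoDist k D) (ctr k) one_pos (fun y z hz => ball_sub_cube y z hz)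
    (exists_ctr_near hk) x x' hxx'
  simp only [div_one] at h
  exact h

/-- `|x − x′| ≤ 1 ⇒ |y_x − y_{x′}| ≤ 1` on the torus. [cite: BalabanImbrieJaffe1985, (5.1.2)–(5.1.3) p.313] -/
theorem near_torus (hk : k ≤ P.m + P.K) (x x' : Site P 0) (hxx' : (torusRep P k D).dS x x' ≤ 1) :
    (torusRep P k D).dY ((torusRep P k D).blk x) ((torusRep P k D).blk x') ≤ 1 := by
  rw [dS_le_iff, one_mul] at hxx'
  have h1 : supDist x x' ≤ P.L ^ k := by exact_mod_cast hxx'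
  rw [torusRep_dY, torusRep_blk, torusRep_blk]
  exact_mod_cast supDist_blk_le_one hk x x' h1

/-- **The cut-offs (1.111) exist on the torus** (`CutoffHyps` with `r₀ = ¼`, `Z = 4`, `s₀ = 0`, `s₁ = 1`): for `|x − x′| ≤ ¼` the piecewise-linear
profile of `|· − y_x|` (`cutoff_of_balls` with the block centres, radius 1) is a `ζ ∈ C₀(Δ̃(y_x))`, `ζ(x) = ζ(x′) = 1`, `|ζ| ≤ 1`, `‖ζ‖_α ≤ 4`;
and `|x − x′| ≤ 1 ⇒ |y_x − y_{x′}| ≤ 1`. [cite: Balaban1984PropagatorsI, (1.111) p.35] -/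
theorem cutoffHyps_torus (hk : k ≤ P.m + P.K) : CutoffHyps (torusRep P k D) (1 / 4) 4 0 1 where
  r₀_pos := by norm_num
  r₀_le_one := by norm_num
  Zc_nonneg := by norm_num
  s₀_nonneg := le_rfl
  s₁_nonneg := zero_le_one
  cutoff := cutoff_torus hk
  near := near_torus hk

/-- THE DISTANCE `|x − y|` BETWEEN `T_η` AND `T₁^{(k)}` in (7.2.2): the `ℓ^∞` torus distance from the fine site `x` to the unit site `y`
(= the centre of `B^k(y)`, a fine site), in the unit of `T₁^{(k)}`. [cite: BalabanImbrieJaffe1985, (7.2.2) p.325] -/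
def distEU (P : Params) (k : ℕ) (x : Site P 0) (y : Site P k) : ℝ := (supDist x (ctr k y) : ℝ) / (P.L : ℝ) ^ k

/-- `|x − y| ≤ |y_x − y| + ½`. [cite: BalabanImbrieJaffe1985, (7.2.2) p.325] -/
theorem distEU_le (hk : k ≤ P.m + P.K) (x : Site P 0) (y : Site P k) :
    distEU P k x y ≤ (torusRep P k D).dY ((torusRep P k D).blk x) y + 1 / 2 := by
  rw [distEU, torusRep_dY, torusRep_blk, div_le_iff₀ (cast_pow_L_pos k)]
  have h1 := supDist_ctr_le hk x y
  have h2 : 2 * supDist x (ctr k y) ≤ P.L ^ k + 2 * (P.L ^ k * supDist (iterBlockOf k x) y) := by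
    have := one_le_pow_L (P := P) k; omega
  have h3 : (2 : ℝ) * (supDist x (ctr k y) : ℝ) ≤ (P.L : ℝ) ^ k + 2 * ((P.L : ℝ) ^ k * (supDist (iterBlockOf k x) y : ℝ)) := by
    exact_mod_cast h2
  nlinarith [cast_pow_L_pos (P := P) k]

/-- `x ≠ x′ ⇒ |x − x′| > 0` for the torus distance. [cite: Balaban1982Higgs1, (1.3) p.604] -/
theorem dS_pos (x x' : Site P 0) (h : x ≠ x') : 0 < (torusRep P k D).dS x x' := by
  rw [torusRep_dS]
  refine div_pos ?_ (cast_pow_L_pos k)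
  have h1 : supDist x x' ≠ 0 := fun h0 => h ((supDist_eq_zero_iff x x').mp h0)
  exact_mod_cast Nat.pos_of_ne_zero h1

/-- `|Dir| = d`. [folklore] -/
private theorem card_dir : Fintype.card (torusRep P k D).Dir = P.d := Fintype.card_fin P.d

/-! ## §D  Row C1.Eq7.2.1-7.2.2 on the torus: `KernelData.Ineq722` for the family of scales -/

/-- THE SECT. 7.2 KERNEL CARRIER OF THE TORUS AT SCALE `k` (`BIJ85Sect7Statements.KernelData` through `kernelDataOf`): `H_{k,μν}(x, y)`,
`|∇H_{k,μν}(x, y)|`, `|∇H_{k,μν}(x, y) − ∇H_{k,μν}(x′, y)|` of the representation (1.103), the distances `|x − y|` (`distEU`), `|x − x′|`,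
`|y − y′|`; the unit-lattice bonds, `|x − b|` and the kernels `C`, `D` of (7.2.3)/(7.2.5) are free parameters (not constrained by (7.2.2)).
[cite: BalabanImbrieJaffe1985, (7.2.1)–(7.2.2) p.325] -/
def torusKernelData (P : Params) (k : ℕ) (D : TorusData P k) (BondU : Type) (distEB : Site P 0 → BondU → ℝ)
    (Cker : Fin P.d → Fin P.d → Site P k → Site P k → ℝ) (Dker : Site P 0 → BondU → ℝ) : KernelData :=
  kernelDataOf (torusRep P k D) BondU (distEU P k) distEB Cker Dker

/-- **Row C1.Eq7.2.1-7.2.2 ON THE TORUS — `KernelData.Ineq722` PROVED for the family of scales of the torus `Setup`**, p. 325: *"there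
exists δ > 0 and for 0 ≤ α < 1 a constant M = M(α) < ∞ such that for |x − x′| ≤ 1, |H_{k,μν}(x,y)| + |∇H_{k,μν}(x,y)| +
|x − x′|^{−α}|∇H_{k,μν}(x,y) − ∇H_{k,μν}(x′,y)| ≤ Me^{−δ|x−y|}. (7.2.2) This inequality is a consequence of Proposition 1.2 and the
representation (1.103) of [6I]."* — for the scales `lev k ≤ m + K` of the torus (any indexing of the standing range by `k ∈ ℕ`), GIVEN at
every scale, with the same constants: the analytic inputs `TorusHyps` ([6I] (1.18) range and row sums of `Q_k`, Prop. 1.1 symmetry,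
(1.100)) and the three displayed members of [6I] Proposition 1.2 (`Prop12Hyps C Cα δ₀`); ALL GEOMETRIC INPUTS of the abstract derivation
(`BIJ85Ineq722ProofPart2.ineq722_of_family`: pseudo-distances, uniform lattice sums, cubes, cut-offs, `|x − y| ≤ |y_x − y| + ½`,
`|x − x′| > 0`) being theorems of the torus. `δ = rate722 d …`, `M(α) = M722 d … α · e^{δ/2}`. [cite: BalabanImbrieJaffe1985, (7.2.2) p.325] -/
theorem ineq722_torus (lev : ℕ → ℕ) (hlev : ∀ k, lev k ≤ P.m + P.K) (D : (k : ℕ) → TorusData P (lev k)) (BondU : ℕ → Type)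
    (distEB : (k : ℕ) → Site P 0 → BondU k → ℝ) (Cker : (k : ℕ) → Fin P.d → Fin P.d → Site P (lev k) → Site P (lev k) → ℝ)
    (Dker : (k : ℕ) → Site P 0 → BondU k → ℝ) {γ₁ q₀ q₁ rQ C δ₀ : ℝ} {Cα : ℝ → ℝ}
    (h : ∀ k, TorusHyps P (lev k) (D k) γ₁ q₀ q₁ rQ) (h12 : ∀ k, (torusRep P (lev k) (D k)).Prop12Hyps C Cα δ₀) :
    KernelData.Ineq722 (fun k => torusKernelData P (lev k) (D k) (BondU k) (distEB k) (Cker k) (Dker k)) :=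
  ineq722_of_family (fun k => torusRep P (lev k) (D k)) BondU (fun k => distEU P (lev k)) distEB Cker Dker (nD := P.d)
    (fun _ => card_dir) (fun k => hyps_torus (hlev k) (h k)) h12 (fun k => cutoffHyps_torus (hlev k))
    (fun k x y => distEU_le (hlev k) x y) (fun _ x x' hne => dS_pos x x' hne)

/-- **The same from [6I] Proposition 1.2 AS TYPED IN THE TREE** (`…Balaban1983to89.B5.Prop12Printed` for the family of torus carriers
`settingOf (torusRep P (lev k) (D k)) k`): the printed implication *"(7.2.2) is a consequence of Proposition 1.2 and the representation
(1.103)"* on the torus, with Prop. 1.2 entering by its name in the tree and only the analytic inputs `TorusHyps` left as hypotheses.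
[cite: BalabanImbrieJaffe1985, (7.2.2) p.325] -/
theorem ineq722_torus_of_prop12Printed (lev : ℕ → ℕ) (hlev : ∀ k, lev k ≤ P.m + P.K) (D : (k : ℕ) → TorusData P (lev k))
    (BondU : ℕ → Type) (distEB : (k : ℕ) → Site P 0 → BondU k → ℝ)
    (Cker : (k : ℕ) → Fin P.d → Fin P.d → Site P (lev k) → Site P (lev k) → ℝ) (Dker : (k : ℕ) → Site P 0 → BondU k → ℝ)
    {γ₁ q₀ q₁ rQ : ℝ} (h : ∀ k, TorusHyps P (lev k) (D k) γ₁ q₀ q₁ rQ)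
    (h12 : B5.Prop12Printed (fun k => settingOf (torusRep P (lev k) (D k)) k)) :
    KernelData.Ineq722 (fun k => torusKernelData P (lev k) (D k) (BondU k) (distEB k) (Cker k) (Dker k)) :=
  ineq722_of_prop12Printed (fun k => torusRep P (lev k) (D k)) BondU (fun k => distEU P (lev k)) distEB Cker Dker (nD := P.d)
    (fun _ => card_dir) (fun k => hyps_torus (hlev k) (h k)) (fun k => cutoffHyps_torus (hlev k)) h12
    (fun k x y => distEU_le (hlev k) x y) (fun _ x x' hne => dS_pos x x' hne)

/-- The canonical indexing of the standing range: `k ↦ min k (m + K)` (the scales `0, 1, …, m + K` of the torus, constant afterwards).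
[cite: Balaban1987RG1, (0.1) p.251] -/
def levStd (P : Params) (k : ℕ) : ℕ := min k (P.m + P.K)

/-- `levStd k ≤ m + K`: the canonical indexing stays in the standing range of `Setup`. [cite: Balaban1987RG1, (0.1) p.251] -/
theorem levStd_le (k : ℕ) : levStd P k ≤ P.m + P.K := min_le_right _ _

/-! ## §E  The averaging kernel of [6I] (1.18) on the torus: `Q_k^*` CONCRETELY; its range and row sums (the `Q`-clauses of `Hyps` discharged) -/

/-- `x′ − iηe_ν`: the site `i` steps BEHIND `x′` in the direction `ν` (inverse of `LatticeFieldCalculus.runSite`). [folklore] -/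
def unrun (x' : Site P 0) (ν : Fin P.d) (i : ℕ) : Site P 0 := Function.update x' ν (x' ν - i)

/-- `x + iηe_ν = x′ ↔ x = x′ − iηe_ν` for the sites `x + te_μ` of the straight contours (1.7). [cite: Balaban1984PropagatorsI, (1.7) p.18] -/
theorem runSite_eq_iff (x x' : Site P 0) (ν : Fin P.d) (i : ℕ) : runSite x ν i = x' ↔ x = unrun x' ν i := by
  constructor
  · rintro rfl
    funext μ
    by_cases h : μ = ν
    · subst h; simp [unrun, runSite]
    · simp [unrun, runSite, h]
  · rintro rfl
    funext μ
    by_cases h : μ = ν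
    · subst h; simp [unrun, runSite]
    · simp [unrun, runSite, h]

/-- Translation along the straight contours (1.7) is a bijection of the torus: exactly one `x` with `x + iηe_ν = x′`.
[cite: Balaban1984PropagatorsI, (1.7) p.18] -/
theorem card_filter_runSite_eq (x' : Site P 0) (ν : Fin P.d) (i : ℕ) :
    (Finset.univ.filter fun x : Site P 0 => runSite x ν i = x').card = 1 := by
  rw [Finset.card_eq_one]
  refine ⟨unrun x' ν i, ?_⟩
  ext x
  simp [runSite_eq_iff]

/-- `|x − (x + iηe_ν)|_∞ ≤ i` (lattice steps) along the straight contours (1.7). [cite: Balaban1984PropagatorsI, (1.7) p.18] -/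
theorem supDist_runSite_le {j : ℕ} (x : Site P j) (ν : Fin P.d) (i : ℕ) : supDist x (runSite x ν i) ≤ i := by
  rw [supDist_eq_sup_cdist]
  refine Finset.sup_le fun μ _ => ?_
  by_cases h : μ = ν
  · subst h
    simp only [runSite, Function.update_self, sub_add_cancel_left, cdist_neg]
    exact (cdist_le_val _).trans (by rw [ZMod.val_natCast]; exact Nat.mod_le _ _)
  · simp [runSite, Function.update_of_ne h, cdist]

/-- THE ONE-STROKE COUNT of (1.18): the number of pairs `(x, i)`, `x ∈ B^k(y)`, `0 ≤ i < L^k`, with `x + iηe_ν = x′` — how many of the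
straight contours `[x, x + e_ν]` (`L^k` fine bonds), `x ∈ B^k(y)`, averaged in `(Q_kA)_ν(y)` pass through the fine bond `⟨x′, x′ + ηe_ν⟩`
(p. 20: *"(Q_kA)_b = Σ_{x∈B^k(b₋)} η^{d+1} A([x, x(b)]) … If b = ⟨y, y + e_μ⟩, then x(b) = x + e_μ"*). [cite: Balaban1984PropagatorsI, (1.18) p.20] -/
def strokeCount (k : ℕ) (x' : Site P 0) (ν : Fin P.d) (y : Site P k) : ℕ :=
  ∑ x ∈ iterBlock k y, ((Finset.range (P.L ^ k)).filter fun i => runSite x ν i = x').card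

/-- `Σ_{y} strokeCount(x′, ν, y) = L^k`: the fine bond `⟨x′, x′ + ηe_ν⟩` lies on exactly `L^k` of the contours `[x, x + e_ν]`, `x ∈ T_η`.
[cite: Balaban1984PropagatorsI, (1.18) p.20] -/
theorem sum_strokeCount_unit (k : ℕ) (x' : Site P 0) (ν : Fin P.d) : ∑ y : Site P k, strokeCount k x' ν y = P.L ^ k := by
  unfold strokeCount iterBlock
  rw [Finset.sum_fiberwise Finset.univ (iterBlockOf k) _]
  simp_rw [Finset.card_filter]
  rw [Finset.sum_comm]
  simp_rw [← Finset.card_filter, card_filter_runSite_eq]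
  simp

/-- `Σ_{x′} strokeCount(x′, ν, y) = L^k · |B^k(y)| = L^k · L^{kd}`: the contours `[x, x + e_ν]`, `x ∈ B^k(y)`, consist of `L^k` fine bonds each
(standing range). [cite: Balaban1984PropagatorsI, (1.18) p.20] -/
theorem sum_strokeCount_fine (hk : k ≤ P.m + P.K) (ν : Fin P.d) (y : Site P k) :
    ∑ x' : Site P 0, strokeCount k x' ν y = P.L ^ k * (P.L ^ P.d) ^ k := by
  unfold strokeCount
  rw [Finset.sum_comm]
  have h1 : ∀ x : Site P 0, ∑ x' : Site P 0, ((Finset.range (P.L ^ k)).filter fun i => runSite x ν i = x').card = P.L ^ k := by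
    intro x
    simp_rw [Finset.card_filter]
    rw [Finset.sum_comm]
    simp
  rw [Finset.sum_congr rfl fun x _ => h1 x, Finset.sum_const, card_iterBlock k hk y, smul_eq_mul, mul_comm]

/-- A nonzero count places `x′` on a contour from the block: `∃ x ∈ B^k(y), i < L^k, x + iηe_ν = x′`. [cite: Balaban1984PropagatorsI, (1.18) p.20] -/
theorem exists_of_strokeCount_ne_zero {x' : Site P 0} {ν : Fin P.d} {y : Site P k} (h : strokeCount k x' ν y ≠ 0) :
    ∃ x : Site P 0, iterBlockOf k x = y ∧ ∃ i, i < P.L ^ k ∧ runSite x ν i = x' := by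
  obtain ⟨x, hx, hx0⟩ := Finset.exists_ne_zero_of_sum_ne_zero h
  rw [mem_iterBlock] at hx
  obtain ⟨i, hi⟩ := Finset.card_ne_zero.mp hx0
  rw [Finset.mem_filter, Finset.mem_range] at hi
  exact ⟨x, hx, i, hi.1, hi.2⟩

/-- **THE KERNEL OF `Q_k^*`** — the adjoint of the `k`-fold bond average (1.18) for the pairings `⟨A, A′⟩_η = η^dΣ_bA_bA′_b` on `T_η`
and `⟨B, B′⟩ = Σ_cB_cB′_c` on `T₁^{(k)}` (so that `Q = η^d(Q^*)ᵀ` is the kernel of `Q_k` itself, `torusRep_std_Q_mulVec`):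
`Q^*(⟨x′, μ⟩, ⟨y, ν⟩) = δ_{μν} · L^{−k} · strokeCount(x′, ν, y)` (from `(Q_kA)_{⟨y,ν⟩} = η^{d+1}Σ_{x∈B^k(y)}Σ_{i<L^k}A_{⟨x+iηe_ν, ν⟩}`,
`η^{d+1}/η^d = η = L^{−k}`). [cite: Balaban1984PropagatorsI, (1.18) p.20] -/
def QsStd (P : Params) (k : ℕ) : Matrix (Site P 0 × Fin P.d) (Site P k × Fin P.d) ℝ :=
  fun j p => if j.2 = p.2 then ((P.L : ℝ) ^ k)⁻¹ * (strokeCount k j.1 p.2 p.1 : ℝ) else 0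

/-- The entries of `Q^*` are nonnegative. [cite: Balaban1984PropagatorsI, (1.18) p.20] -/
theorem QsStd_nonneg (j : Site P 0 × Fin P.d) (p : Site P k × Fin P.d) : 0 ≤ QsStd P k j p := by
  unfold QsStd
  split_ifs
  · exact mul_nonneg (inv_nonneg.mpr (cast_pow_L_pos k).le) (Nat.cast_nonneg _)
  · exact le_rfl

/-- **Row sums of `Q^*`: `Σ_c Q^*(b, c) = 1`** for every fine bond `b` (so `|Q^*B| ≤ |B|`: `q₀ = 1`).
[cite: Balaban1984PropagatorsI, (1.18) p.20] -/
theorem QsStd_row (j : Site P 0 × Fin P.d) : ∑ p : Site P k × Fin P.d, |QsStd P k j p| = 1 := by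
  have hL : ((P.L : ℝ) ^ k) ≠ 0 := (cast_pow_L_pos k).ne'
  calc ∑ p : Site P k × Fin P.d, |QsStd P k j p| = ∑ p : Site P k × Fin P.d, QsStd P k j p :=
        Finset.sum_congr rfl fun p _ => abs_of_nonneg (QsStd_nonneg j p)
    _ = ∑ y : Site P k, ((P.L : ℝ) ^ k)⁻¹ * (strokeCount k j.1 j.2 y : ℝ) := by
        rw [Fintype.sum_prod_type]
        refine Finset.sum_congr rfl fun y _ => ?_
        unfold QsStd
        rw [Finset.sum_ite_eq Finset.univ j.2]
        simp
    _ = ((P.L : ℝ) ^ k)⁻¹ * ((∑ y : Site P k, strokeCount k j.1 j.2 y : ℕ) : ℝ) := by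
        rw [← Finset.mul_sum, Nat.cast_sum]
    _ = 1 := by rw [sum_strokeCount_unit, Nat.cast_pow, inv_mul_cancel₀ hL]

/-- **Range of `Q^*`: `Q^*(⟨x′, μ⟩, ⟨y, ν⟩) ≠ 0 ⟹ |y_{x′} − y|_∞ ≤ 1`** — a fine bond read by `(Q_kA)_ν(y)` lies on a contour `[x, x + e_ν]`,
`x ∈ B^k(y)`, hence within `L^k − 1` fine steps of `B^k(y)`: its own block is `y` or a neighbour of `y` (`r_Q = 1`; standing range).
[cite: Balaban1984PropagatorsI, (1.18) p.20] -/
theorem QsStd_range (hk : k ≤ P.m + P.K) (j : Site P 0 × Fin P.d) (p : Site P k × Fin P.d) (h : QsStd P k j p ≠ 0) :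
    (supDist (iterBlockOf k j.1) p.1 : ℝ) ≤ 1 := by
  unfold QsStd at h
  split_ifs at h with hμ
  · have h0 : strokeCount k j.1 p.2 p.1 ≠ 0 := by
      intro h0; apply h; rw [h0, Nat.cast_zero, mul_zero]
    obtain ⟨x, hx, i, hi, hxi⟩ := exists_of_strokeCount_ne_zero h0
    have h1 : supDist x j.1 ≤ P.L ^ k := by rw [← hxi]; exact (supDist_runSite_le x p.2 i).trans hi.le
    have h2 := supDist_blk_le_one hk x j.1 h1
    rw [hx, supDist_comm] at h2
    exact_mod_cast h2
  · exact absurd rfl h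

/-- THE TORUS DATA WITH THE AVERAGING KERNEL OF (1.18): `G`, `∇G` given, `Q^* = QsStd`. [cite: Balaban1984PropagatorsI, (1.103) p.34] -/
def stdData (k : ℕ) (G : Matrix (Site P 0 × Fin P.d) (Site P 0 × Fin P.d) ℝ)
    (DG : Matrix (Site P 0 × Fin P.d × Fin P.d) (Site P 0 × Fin P.d) ℝ) : TorusData P k := ⟨G, DG, QsStd P k⟩

variable {G : Matrix (Site P 0 × Fin P.d) (Site P 0 × Fin P.d) ℝ} {DG : Matrix (Site P 0 × Fin P.d × Fin P.d) (Site P 0 × Fin P.d) ℝ}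

/-- `η^d · L^{kd} = 1` (`η = L^{−k}`). [folklore] -/
private theorem eta_pow_mul : P.eta k ^ P.d * (((P.L : ℝ) ^ P.d) ^ k) = 1 := by
  unfold Params.eta
  rw [← pow_mul, ← pow_mul, mul_comm P.d k, ← mul_pow, inv_mul_cancel₀ P.cast_L_pos.ne', one_pow]

/-- `η^d · L^{−k} = η^{d+1}`. [folklore] -/
private theorem eta_pow_mul_inv : P.eta k ^ P.d * ((P.L : ℝ) ^ k)⁻¹ = P.eta k ^ (P.d + 1) := by
  unfold Params.eta
  rw [pow_succ, inv_pow]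

/-- unfolding: the kernel of `Q_k` for the standard data, `Q(⟨y,ν⟩, ⟨x′,μ⟩) = η^d Q^*(⟨x′,μ⟩, ⟨y,ν⟩)`. [cite: Balaban1984PropagatorsI, (1.18) p.20] -/
theorem torusRep_std_Q_apply (p : Site P k × Fin P.d) (j : Site P 0 × Fin P.d) :
    (torusRep P k (stdData k G DG)).Q p j = P.eta k ^ P.d * QsStd P k j p := rfl

/-- **`Q = η^d(Q^*)ᵀ` IS THE `k`-FOLD BOND AVERAGE (1.18) of the tree**: for every fine bond field `A`,
`Σ_b Q(c, b)A_b = (Q_kA)_c = LatticeFieldCalculus.bondAvgIter k A c` (through the one-stroke formula `B5Eq118OneStroke.eq118`; standing range).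
[cite: Balaban1984PropagatorsI, (1.18) p.20] -/
theorem torusRep_std_Q_mulVec (hk : k ≤ P.m + P.K) (A : VecField P 0 ℝ) (p : Site P k × Fin P.d) :
    ((torusRep P k (stdData k G DG)).Q *ᵥ fun j => A ⟨j.1, j.2⟩) p = bondAvgIter k A ⟨p.1, p.2⟩ := by
  rw [eq118 hk]
  show ∑ j : Site P 0 × Fin P.d, (torusRep P k (stdData k G DG)).Q p j * A ⟨j.1, j.2⟩ = _
  simp only [torusRep_std_Q_apply]
  -- collapse the direction index
  have h1 : ∑ j : Site P 0 × Fin P.d, P.eta k ^ P.d * QsStd P k j p * A ⟨j.1, j.2⟩ =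
      ∑ x' : Site P 0, P.eta k ^ (P.d + 1) * ((strokeCount k x' p.2 p.1 : ℝ) * A ⟨x', p.2⟩) := by
    rw [Fintype.sum_prod_type]
    refine Finset.sum_congr rfl fun x' _ => ?_
    have : ∀ μ : Fin P.d, P.eta k ^ P.d * QsStd P k (x', μ) p * A ⟨x', μ⟩ =
        if μ = p.2 then P.eta k ^ (P.d + 1) * ((strokeCount k x' p.2 p.1 : ℝ) * A ⟨x', μ⟩) else 0 := by
      intro μ
      unfold QsStd
      split_ifs with h
      · rw [← eta_pow_mul_inv]; ring
      · rw [mul_zero, zero_mul]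
    rw [Finset.sum_congr rfl fun μ _ => this μ, Finset.sum_ite_eq' Finset.univ p.2]
    simp
  rw [h1, ← Finset.mul_sum]
  -- expand the count and resum over the contours
  have h2 : ∑ x' : Site P 0, (strokeCount k x' p.2 p.1 : ℝ) * A ⟨x', p.2⟩ =
      ∑ x ∈ iterBlock k p.1, ∑ i ∈ Finset.range (P.L ^ k), A ⟨runSite x p.2 i, p.2⟩ := by
    unfold strokeCount
    simp_rw [Nat.cast_sum, Finset.card_filter, Nat.cast_sum, Finset.sum_mul]
    rw [Finset.sum_comm]
    refine Finset.sum_congr rfl fun x _ => ?_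
    rw [Finset.sum_comm]
    refine Finset.sum_congr rfl fun i _ => ?_
    simp_rw [Nat.cast_ite, Nat.cast_one, Nat.cast_zero, ite_mul, one_mul, zero_mul]
    rw [Finset.sum_ite_eq Finset.univ (runSite x p.2 i)]
    simp
  rw [h2, Finset.mul_sum]
  refine Finset.sum_congr rfl fun x _ => ?_
  rw [segSum, Finset.smul_sum, Finset.mul_sum]
  rfl

/-- **Row sums of `Q`: `Σ_b |Q(c, b)| = 1`** (`|Q_kA| ≤ |A|`, `q₁ = 1`; `η^d · L^{−k} · L^k · L^{kd} = 1`; standing range).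
[cite: Balaban1984PropagatorsI, (1.18) p.20] -/
theorem torusRep_std_Q_row (hk : k ≤ P.m + P.K) (p : Site P k × Fin P.d) :
    ∑ j : Site P 0 × Fin P.d, |(torusRep P k (stdData k G DG)).Q p j| = 1 := by
  have hη : 0 ≤ P.eta k ^ P.d := pow_nonneg (pow_nonneg (inv_nonneg.mpr P.cast_L_pos.le) _) _
  have hL : ((P.L : ℝ) ^ k) ≠ 0 := (cast_pow_L_pos k).ne'
  calc ∑ j : Site P 0 × Fin P.d, |(torusRep P k (stdData k G DG)).Q p j|
      = ∑ j : Site P 0 × Fin P.d, P.eta k ^ P.d * QsStd P k j p := by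
        refine Finset.sum_congr rfl fun j _ => ?_
        rw [torusRep_std_Q_apply, abs_of_nonneg (mul_nonneg hη (QsStd_nonneg j p))]
    _ = ∑ x' : Site P 0, P.eta k ^ P.d * (((P.L : ℝ) ^ k)⁻¹ * (strokeCount k x' p.2 p.1 : ℝ)) := by
        rw [Fintype.sum_prod_type]
        refine Finset.sum_congr rfl fun x' _ => ?_
        unfold QsStd
        simp_rw [mul_ite, mul_zero]
        rw [Finset.sum_ite_eq' Finset.univ p.2]
        simp
    _ = P.eta k ^ P.d * ((P.L : ℝ) ^ k)⁻¹ * ((∑ x' : Site P 0, strokeCount k x' p.2 p.1 : ℕ) : ℝ) := by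
        rw [Nat.cast_sum, Finset.mul_sum]
        refine Finset.sum_congr rfl fun x' _ => ?_
        ring
    _ = 1 := by
        rw [sum_strokeCount_fine hk, Nat.cast_mul, Nat.cast_pow, Nat.cast_pow, Nat.cast_pow]
        calc P.eta k ^ P.d * ((P.L : ℝ) ^ k)⁻¹ * ((P.L : ℝ) ^ k * ((P.L : ℝ) ^ P.d) ^ k)
            = P.eta k ^ P.d * ((P.L : ℝ) ^ P.d) ^ k * (((P.L : ℝ) ^ k)⁻¹ * (P.L : ℝ) ^ k) := by ring
          _ = 1 := by rw [eta_pow_mul, inv_mul_cancel₀ hL, one_mul]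

/-- THE ANALYTIC INPUTS LEFT for the standard data: the symmetry of `G` ([6I] Prop. 1.1) and the lower bound (1.100) `γ₁‖w‖² ≤ ⟨w, QGQ^*w⟩`
— the `Q`-clauses of `TorusHyps` being theorems (`q₀ = q₁ = r_Q = 1`). [cite: Balaban1984PropagatorsI, (1.100) p.34] -/
theorem torusHyps_std (hk : k ≤ P.m + P.K) {γ₁ : ℝ} (hγ : 0 < γ₁) (hG : G.IsSymm)
    (hM : ∀ w : Site P k × Fin P.d → ℝ, γ₁ * ∑ p, w p ^ 2 ≤ ∑ p, w p * ((torusRep P k (stdData k G DG)).M *ᵥ w) p) :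
    TorusHyps P k (stdData k G DG) γ₁ 1 1 1 where
  γ₁_pos := hγ
  q₀_nonneg := zero_le_one
  q₁_nonneg := zero_le_one
  rQ_nonneg := zero_le_one
  Qs_range := fun j p h => QsStd_range hk j p h
  Qs_row := fun j => (QsStd_row j).le
  Q_row := fun p => (torusRep_std_Q_row hk p).le
  G_symm := hG
  M_lower := hM

/-- **Row C1.Eq7.2.1-7.2.2 ON THE TORUS WITH THE AVERAGING OPERATORS OF (1.18)** — `KernelData.Ineq722` for the family of scales
`lev k ≤ m + K`, the kernels `G_k = G̃_k(ΩA)`, `∇G_k` GIVEN with: the symmetry of `G_k` ([6I] Prop. 1.1), the lower bound (1.100) at a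
k-independent `γ₁`, and the three displayed members of [6I] Prop. 1.2 (`Prop12Hyps C Cα δ₀`); everything else (geometry, cut-offs,
`Q_k`, `Q_k^*`) a theorem of the torus. [cite: BalabanImbrieJaffe1985, (7.2.2) p.325] -/
theorem ineq722_torusStd (lev : ℕ → ℕ) (hlev : ∀ k, lev k ≤ P.m + P.K)
    (G : (k : ℕ) → Matrix (Site P 0 × Fin P.d) (Site P 0 × Fin P.d) ℝ)
    (DG : (k : ℕ) → Matrix (Site P 0 × Fin P.d × Fin P.d) (Site P 0 × Fin P.d) ℝ) (BondU : ℕ → Type)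
    (distEB : (k : ℕ) → Site P 0 → BondU k → ℝ) (Cker : (k : ℕ) → Fin P.d → Fin P.d → Site P (lev k) → Site P (lev k) → ℝ)
    (Dker : (k : ℕ) → Site P 0 → BondU k → ℝ) {γ₁ C δ₀ : ℝ} {Cα : ℝ → ℝ} (hγ : 0 < γ₁) (hG : ∀ k, (G k).IsSymm)
    (hM : ∀ (k : ℕ) (w : Site P (lev k) × Fin P.d → ℝ),
      γ₁ * ∑ p, w p ^ 2 ≤ ∑ p, w p * ((torusRep P (lev k) (stdData (lev k) (G k) (DG k))).M *ᵥ w) p)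
    (h12 : ∀ k, (torusRep P (lev k) (stdData (lev k) (G k) (DG k))).Prop12Hyps C Cα δ₀) :
    KernelData.Ineq722
      (fun k => torusKernelData P (lev k) (stdData (lev k) (G k) (DG k)) (BondU k) (distEB k) (Cker k) (Dker k)) :=
  ineq722_torus lev hlev (fun k => stdData (lev k) (G k) (DG k)) BondU distEB Cker Dker
    (fun k => torusHyps_std (hlev k) hγ (hG k) (hM k)) h12

/-- **The same with [6I] Proposition 1.2 by its tree name** (`B5.Prop12Printed` for the family of torus carriers): (7.2.2) on the torus as
*"a consequence of Proposition 1.2 and the representation (1.103)"*, GIVEN ONLY the symmetry of `G_k` and (1.100).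
[cite: BalabanImbrieJaffe1985, (7.2.2) p.325] -/
theorem ineq722_torusStd_of_prop12Printed (lev : ℕ → ℕ) (hlev : ∀ k, lev k ≤ P.m + P.K)
    (G : (k : ℕ) → Matrix (Site P 0 × Fin P.d) (Site P 0 × Fin P.d) ℝ)
    (DG : (k : ℕ) → Matrix (Site P 0 × Fin P.d × Fin P.d) (Site P 0 × Fin P.d) ℝ) (BondU : ℕ → Type)
    (distEB : (k : ℕ) → Site P 0 → BondU k → ℝ) (Cker : (k : ℕ) → Fin P.d → Fin P.d → Site P (lev k) → Site P (lev k) → ℝ)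
    (Dker : (k : ℕ) → Site P 0 → BondU k → ℝ) {γ₁ : ℝ} (hγ : 0 < γ₁) (hG : ∀ k, (G k).IsSymm)
    (hM : ∀ (k : ℕ) (w : Site P (lev k) × Fin P.d → ℝ),
      γ₁ * ∑ p, w p ^ 2 ≤ ∑ p, w p * ((torusRep P (lev k) (stdData (lev k) (G k) (DG k))).M *ᵥ w) p)
    (h12 : B5.Prop12Printed (fun k => settingOf (torusRep P (lev k) (stdData (lev k) (G k) (DG k))) k)) :
    KernelData.Ineq722
      (fun k => torusKernelData P (lev k) (stdData (lev k) (G k) (DG k)) (BondU k) (distEB k) (Cker k) (Dker k)) :=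
  ineq722_torus_of_prop12Printed lev hlev (fun k => stdData (lev k) (G k) (DG k)) BondU distEB Cker Dker
    (fun k => torusHyps_std (hlev k) hγ (hG k) (hM k)) h12

end

end Literature.MathematicalPhysics.QuantumFieldTheory.BalabanImbrieJaffe1984to88.BIJ85Ineq722Torus
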